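import Summits.ResolutionOfSingularities.ResolutionOfSingularities.Theses.WeightedInvariant
import Summits.ResolutionOfSingularities.ResolutionOfSingularities.Theses.Descent
import Summits.ResolutionOfSingularities.ResolutionOfSingularities.Theses.UniformComplexity
import Summits.ResolutionOfSingularities.ResolutionOfSingularities.Theses.PAlteration
import Literature.Barriers.ResolutionOfSingularities.InseparableBaseChangeResolution
import Literature.Barriers.ResolutionOfSingularities.RegularNotGeometricallyRegular
import Literature.Barriers.ResolutionOfSingularities.FrobeniusTwistResolution

/-!
# Disproof of `DescentPerfectToAll` (crux stmt-ResolutionOfSingularities-0549) — findings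

Standing adversary file (cdisprove, generation 3, v6 2026-08-16; gen-1 file v1–v3 by
refuter-cdisprove-stmt-ResolutionOfSingularities-0549-0, whose §3–§5 LANDED as
`Literature.Barriers.ResolutionOfSingularities.InseparableBaseChangeResolution`, p68332; gen-2 v4–v5
landed p69541, p69878 and typed §5–§8).
Prose only in docstrings; every `theorem` below is sorry-free except (i) the §10 typed near-miss
`not_smoothModelAfterFGEnlargement` (on-paper refutation of a strengthening of the picked line's core
stub; scheme-level curve theory not in tree) and (ii) the bookkeeping `sorry` of §8 (v6): the §8 card-lemma refutation
`not_invariantsRegularOfNonsingularDerivation` has LANDED as the negative lemmas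
`Theorems/DescentPerfectToAll/Negative/ConstantsOfTwistedDerivation.lean` (p73716 ACCEPTED) +
`…/InvariantsRegularOfNonsingularDerivationFalse.lean` (p73820 ACCEPTED); in THIS revision of the work
file the §8 theorem still carries a bookkeeping `sorry` because the farm had not yet built the new module
when v6 was published (swap in `import …Negative.InvariantsRegularOfNonsingularDerivationFalse` +
`exact …Negative.not_invariantsRegularOfNonsingularDerivation p` — prepared in the gen-3 folder as
Disproof.lean, checked modulo the farm build).

The crux (shared verbatim by routes Descent r2 / WeightedInvariant r4 / UniformComplexity r3):
`∀ p prime, PerfectRes p → ResolutionInChar.{0} p` — resolution of every reduced separated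
finite-type scheme over every PERFECT field of characteristic `p` implies it over EVERY field of
characteristic `p`.

## Index of findings

* §1 LOGICAL POSITION (certified): the three route decls are one proposition (`rfl`); summit ⇒ crux;
  summit ↔ (∀ p, PerfectRes p) ∧ crux; `¬ crux ↔ ∃ p prime, PerfectRes p ∧ ¬ ResolutionInChar p` —
  UNFALSIFIABLE BY INSTANCES (a refutation is a counterexample to resolution in char `p`, dim ≥ 4,
  over an imperfect field, together with a proof of resolution over all perfect fields of that
  characteristic); WLOG `k` imperfect (`crux_iff_imperfect`), WLOG `X` integral
  (`crux_iff_integral`), and given the vendored `CossartPiltant2019` WLOG `dim X ≥ 4`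
  (`crux_iff_dim_gt_three`).
* §2 LOAD-BEARING HYPOTHESES (certified): `p.Prime` is decoration (`cruxWithoutPrime_iff`);
  dropping the antecedent = the summit (`cruxWithoutAntecedent_iff`); dropping `[PerfectField]`
  from the antecedent makes the crux the identity (`cruxWithoutPerfect`); `IsReduced` cannot be
  dropped from the antecedent — it becomes FALSE (`not_perfectResNonreduced`, witness
  `Spec 𝔽_p[ε]`) so that variant is vacuously true; dropped from the consequent the variant is
  equivalent to `∀ p prime, ¬ PerfectRes p` (`cruxWithoutReducedInConsequent_iff`). So ALL content
  sits in the imperfect ground field, exactly as the planners say.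
* §3 MECHANISMS REFUTED (landed, imported): resolve-then-base-change and "regular is geometrically
  regular" are false already for `Spec K`, `K = 𝔽_p(t)(t^{1/p})`
  (`not_hasResolution_stable_groundFieldExtension`, `not_isRegular_stable_groundFieldExtension`,
  `InseparableBaseChangeResolution`, p68332); NEW in gen 2, proposed as
  `Literature/Barriers/ResolutionOfSingularities/RegularNotGeometricallyRegular.lean` (p69541,
  ACCEPTED 2026-08-15T23:08Z, commit e4f918f72df6; imported): the GEOMETRICALLY INTEGRAL instance — Kollár 2007 §1.19
  `y² = x^p − t` over `𝔽_p(t)`: `A_𝔭` regular at `𝔭 = (x^p − t, y)` while `(K ⊗ₖ A)` is singular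
  over `𝔭` — proved at ring level for every `p` (and exponent `q ≥ 2`); closes scope caveat (b) of
  p68332: base-changing a resolution of a model fails even when the base change is reduced/integral.
  §3 here re-derives the typed corollaries at the crux's own quantifier shape.
* §4 MORE MECHANISMS REFUTED (new in gen 2, LANDED as
  `Literature.Barriers.ResolutionOfSingularities.FrobeniusTwistResolution`, p69878 ACCEPTED
  2026-08-15T23:17Z, commit 77411e70c6ce; imported): `Scheme.HasResolution` is not invariant under
  finite universal homeomorphisms in EITHER direction (`Spec K` vs its Frobenius twist
  `Spec k[x]/((x − t)^p) = Spec (K ⊗_{k,Frob} k)`, with the relative Frobenius and the projection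
  exhibited); so "pass to the perfect closure, resolve, come back by a power of Frobenius" resolves
  a TWIST of `X`, never `X`, and `(·)_red` of the twist loses the map. Re-exported here as
  `hasResolution_not_invariant_univHomeo`.
* §5 WHAT THE ANTECEDENT BUYS (typed, for planners): `PerfectRes p` ⇒ purely inseparable regular
  ALTERATIONS of every integral `X` over every field of char `p` (perfect closure + EGA IV₃ 8.10.5 /
  IV₄ 17.7.8 descent) = crux `Pialt` of route pAlteration restricted to `p` (`PerfectResToPialt`,
  stated; the residue of 0549 after this step is exactly pAlteration's `Picover`/`RadicialBottom`
  wall — Temkin's "inseparable case" — not something cheaper).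
* §6 PROVABLE SUB-CASES (typed, for the tenure split): `PerfectToSeparableOverModel` (X has a model
  over `K₀` finitely generated over a perfect field with `k/K₀` separable; mechanism: spread over a
  variety over the perfect field, resolve the total space by the antecedent, take the generic fibre,
  base-change along the REGULAR morphism `Spec k → Spec K₀`), its special cases
  `PerfectToFinitelyGenerated` (`K₀ = k`) and purely transcendental extensions; all follow from the
  crux (`…_of_crux`). RESIDUAL HARD CASE, typed: `LaurentSeriesCase p` (`k = 𝔽_p((t))`: p-rank 1,
  maximal perfect subfield `𝔽_p`, so every field of definition of transcendence degree ≥ 2 sits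
  inseparably below `k` — MacLane), `laurentSeriesCase_of_crux`.
* §8 CARDS ON FILE (round 1, 4 cards, read 2026-08-15T23:30Z): none of §3–§4 bites any lever (all
  four start from §5/§6 and never transport regularity along an inseparable base change — by
  design); first lemmas `PerfectClosureDescent`, `OneStepDetection`, `SeparableAscent`,
  `PropagationFromClosedFibre`, `KunzCriterion`, `RegularDescendsFlatLocal` pass the paper check;
  **`InvariantsRegularOfNonsingularDerivation` (card constant-foliation-descent) is FALSE as typed**
  — witness `R = k⟦x,y,z⟧`, `D = ∂ₓ + x(y∂_y + z∂_z)` (not p-closed): `ker D` is the cyclic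
  quotient singularity `(1/p)(1,1) × line`; repair = add p-closedness (`not_invariantsRegular…`,
  §8). GEN 3: PROVED IN LEAN for every prime `p` (4 test monomials `x^p, y^p, y^{p-1}z, z^p` in
  `𝔪_S` with multiplicative test coefficients vs. `spanFinrank 𝔪_S = dim S = 3`), filed as the
  negative lemmas `…Theorems.DescentPerfectToAll.Negative.{ConstantsOfTwistedDerivation,
  InvariantsRegularOfNonsingularDerivationFalse}` (p73716, p73820 ACCEPTED; imported, `exact` in §8).
  PART 3 LANDED too: `…Negative.TwistedDerivationNotPClosed` (p74285) — the witness `D` is NOT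
  p-closed (`not_pClosed`: `¬ ∃ a, ∀ x, D^[p] x = a * D x`; `D^[n] X₁ = q_n(X₀)X₁`, `q_n` monic), so
  the refutation separates the card lemma from its repair EXACTLY at p-closedness (the witness meets
  every other hypothesis of `InvariantsRegularOfPClosedNonsingularDerivation`).
* §9 TRIAGE ROUND 1 DIGEST (gen 3, for the lead; 3 reports `TRIAGE-r1-{1,2,3}.md`): 5 pass / 1 fail
  (absolutize-the-datum = costume of the summit, cf. `cruxWithoutAntecedent_iff`); merges
  constant-foliation-descent ≈ frobenius-sandwich-foliation ≈ root-of-a-constant (one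
  constant/arithmetic rank-one p-closed foliation descent line) and arc-special-fibre-transversality ≈
  lambda-tower-one-step; typed verdicts on the cards' first lemmas (`taylor_expansion_of_derivation`,
  `kummer_cover_of_constant_regular_iff`, `PropagationFromClosedFibre`, `KunzCriterion`,
  `OneStepDetection`, `SeparableAscent`: TRUE on paper — not attack targets; only
  `InvariantsRegularOfNonsingularDerivation` is false); ON-PAPER REFUTATION (TRIAGE-r1-1 App. A, not
  formalisable here): the SCHEME-level transfer `(★★)₂` of root-of-a-constant is false for every
  `p ≥ 5` (constant extension of `k'(E × E)`, `E` supersingular: every regular proper model keeps a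
  multiplicative non-Euler singular point of the constant foliation; quotient germ `C₁[α̃]`, `C₁` the
  `(1/p)(a,b)` toric germ, not regular; flat descent) — only the STACKY reading (3b) survives; common
  honesty clause: every surviving line's local core is a purely inseparable hypersurface germ
  `T^p = h(y₁, …, y_d)` in `d = dim X` variables, so `DimensionFourFrontier` bites at `d = 4`
  exactly as §5 predicts.
* §10 TARGETS — PICKED LINE `arc-special-fibre-transversality` (gen 3, lead skeleton 2026-08-16T01:24Z):
  stub audit — stubs 1, 3, 4, 5 TRUE as typed (3 without Noetherian `R`; 4 in every characteristic
  via Tor-dimension, not Kunz; 5 by universal openness of field base change); stub 2 (core) is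
  summit-implied ONLY via compactify-first + spread over a smooth `𝔽̄_p`-variety + closed point in
  the open regular locus (no resolution of the model — the weak `HasResolution` forbids modifying
  `Y` again), and is CRUX-COMPLETE; refuted strengthening typed: `SmoothModelAfterFGEnlargement`
  (= what `R` a field / `Frac R ⊇ L'^{perf}` would force) is false for every `p` (regular non-smooth
  curve; near-miss `not_smoothModelAfterFGEnlargement`, the file's only `sorry`) ⇒ the arc must be
  non-constant.
* §7 NEAR-MISSES / OPEN REGIMES (docstrings): (i) finite determinacy
  over `𝔽_p((t))` reduces isolated singularities to models over `𝔽_p(t) ⊂ 𝔽_p((t))` (separable!) up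
  to ÉTALE-local isomorphism — lands in crux 0550's Galois/étale-descent problem, not in 0549;
  (ii) no dimension ≤ 3 content (CP2019); (iii) irrefutability certificate of §1.

## Census of attacks (gen 1 + gen 2 + gen 3)
instances/junk models → irrefutable (§1); hypothesis drops → §2; resolve-then-base-change →
refuted twice (§3: non-reduced point p68332; geometrically integral curve p69541); Frobenius
twist / perfect closure → §4 (+ §5: it yields alterations only); spreading-out → §6 (works iff
separable over a f.g. field of definition); literature 2026-08-15 (Temkin2008 Q3.3.3 open,
CossartPiltant2009 hypothesis, Kollár 1.19, Liu 7.3.15, BGMW2011/Kollár 3.34.2 descend only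
functorial resolutions, Temkin2013 inseparable local uniformization = per-valuation only): no
perfect→all lemma in print, no counterexample in print. Gen 3: card-lemma refutation of §8 formalised
(2 negative-lemma files); typed first lemmas of all 6 round-1 cards audited (§9: only the §8 one is
false); triage App. A scheme-level `(★★)₂` kill recorded (§9).
-/

noncomputable section

set_option linter.dupNamespace false

open AlgebraicGeometry CategoryTheory CategoryTheory.Limits Polynomial
open Literature.AlgebraicGeometry.Resolution
open Literature.Barriers.ResolutionOfSingularities

namespace Summit.ResolutionOfSingularities.ResolutionOfSingularities.Cruxes.DescentPerfectToAll.Disproof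

/-! ## §1 Logical position -/

/-- The crux, by name (route WeightedInvariant's copy). -/
abbrev Crux : Prop :=
  Summit.ResolutionOfSingularities.ResolutionOfSingularities.Theses.WeightedInvariant.DescentPerfectToAll

/-- The three routes want literally the same proposition. [folklore] -/
theorem crux_eq_descent :
    Crux = Summit.ResolutionOfSingularities.ResolutionOfSingularities.Theses.Descent.DescentPerfectToAll :=
  rfl

/-- The three routes want literally the same proposition. [folklore] -/
theorem crux_eq_uniformComplexity :
    Crux = Summit.ResolutionOfSingularities.ResolutionOfSingularities.Theses.UniformComplexity.DescentPerfectToAll :=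
  rfl

/-- The antecedent: resolution over PERFECT fields of characteristic `p` (= `WeightedThesis` at
`p`). -/
def PerfectRes (p : ℕ) : Prop :=
  ∀ (k : Type) [Field k] [CharP k p] [PerfectField k] (X : Scheme.{0}) (f : X ⟶ Spec (.of k)),
    IsSeparated f → LocallyOfFiniteType f → QuasiCompact f → IsReduced X → Scheme.HasResolution X

/-- Unfolding. [folklore] -/
theorem crux_iff : Crux ↔ ∀ p : ℕ, p.Prime → PerfectRes p → ResolutionInChar.{0} p := Iff.rfl

/-- The consequent contains the antecedent. [folklore] -/
theorem perfectRes_of_resolutionInChar {p : ℕ} (h : ResolutionInChar.{0} p) : PerfectRes p :=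
  fun k _ _ _ X f a b c d => h k X f a b c d

/-- Summit ⇒ crux (so `¬ crux ⇒ ¬ summit`: the crux is irrefutable short of a counterexample to
resolution of singularities in positive characteristic). [folklore] -/
theorem crux_of_summit (h : _root_.ResolutionOfSingularities) : Crux := fun p hp _ => h p hp

/-- Lossless decomposition: summit ↔ perfect case ∧ crux. [folklore] -/
theorem summit_iff_perfectRes_and_crux :
    _root_.ResolutionOfSingularities ↔ (∀ p : ℕ, p.Prime → PerfectRes p) ∧ Crux :=
  ⟨fun h => ⟨fun p hp => perfectRes_of_resolutionInChar (h p hp), crux_of_summit h⟩,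
    fun ⟨h1, h2⟩ p hp => h2 p hp (h1 p hp)⟩

/-- What a refutation must be: a prime `p` with resolution over all perfect fields of char `p`
AND a reduced separated finite-type scheme over some (imperfect) field of char `p` without
resolution. Neither conjunct is available (the first is the open perfect-field conjecture, the
second a counterexample to resolution in dim ≥ 4). [folklore] -/
theorem not_crux_iff : ¬ Crux ↔ ∃ p : ℕ, p.Prime ∧ PerfectRes p ∧ ¬ ResolutionInChar.{0} p := by
  rw [crux_iff]
  push Not
  rfl

/-- Resolution over IMPERFECT fields of characteristic `p` only. -/
def ImperfectRes (p : ℕ) : Prop :=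
  ∀ (k : Type) [Field k] [CharP k p], ¬ PerfectField k → ∀ (X : Scheme.{0}) (f : X ⟶ Spec (.of k)),
    IsSeparated f → LocallyOfFiniteType f → QuasiCompact f → IsReduced X → Scheme.HasResolution X

/-- WLOG `k` imperfect: the crux is exactly "perfect ⇒ imperfect". [folklore] -/
theorem crux_iff_imperfect : Crux ↔ ∀ p : ℕ, p.Prime → PerfectRes p → ImperfectRes p := by
  refine ⟨fun h p hp hP k _ _ _ X f a b c d => h p hp hP k X f a b c d, fun h p hp hP k _ _ X f a b c d => ?_⟩
  by_cases hk : PerfectField k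
  · exact hP k X f a b c d
  · exact h p hp hP k hk X f a b c d

/-- WLOG `X` integral (components are resolved separately and glued: in-tree
`resolutionInChar_iff_integral`). [folklore] -/
theorem crux_iff_integral :
    Crux ↔ ∀ p : ℕ, p.Prime → PerfectRes p → IntegralResolutionInChar.{0} p := by
  simp only [crux_iff, resolutionInChar_iff_integral]

/-- Resolution in characteristic `p` for schemes of dimension `> 3` only. -/
def ResolutionInCharDimGtThree (p : ℕ) : Prop :=
  ∀ (k : Type) [Field k] [CharP k p] (X : Scheme.{0}) (f : X ⟶ Spec (.of k)),
    IsSeparated f → LocallyOfFiniteType f → QuasiCompact f → IsReduced X →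
      3 < topologicalKrullDim X → Scheme.HasResolution X

/-- Given the vendored named fact `CossartPiltant2019` (dim ≤ 3, all fields), the crux has
content only in dimension ≥ 4. [cite: CossartPiltant2019, Thm. 1.1] -/
theorem crux_iff_dim_gt_three (hCP : CossartPiltant2019.{0}) :
    Crux ↔ ∀ p : ℕ, p.Prime → PerfectRes p → ResolutionInCharDimGtThree p := by
  refine ⟨fun h p hp hP k _ _ X f a b c d _ => h p hp hP k X f a b c d, fun h p hp hP k _ _ X f a b c d => ?_⟩
  by_cases hdim : topologicalKrullDim X ≤ 3
  · haveI := a; haveI := b; haveI := c; haveI := d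
    exact hasResolution_of_dim_le_three hCP k X f hdim
  · exact h p hp hP k X f a b c d (not_le.mp hdim)

/-! ## §2 Load-bearing hypotheses -/

/-- The crux with `p.Prime` dropped. -/
def CruxWithoutPrime : Prop := ∀ p : ℕ, PerfectRes p → ResolutionInChar.{0} p

/-- `p.Prime` is decoration: for `p = 0` every field is perfect, for composite `p` (and `p = 1`)
there is no field of characteristic `p`. Any proof may ignore `hp`. [folklore] -/
theorem cruxWithoutPrime_iff : CruxWithoutPrime ↔ Crux := by
  refine ⟨fun h p _ => h p, fun h p hP k _ _ X f a b c d => ?_⟩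
  rcases CharP.char_is_prime_or_zero k p with hp | rfl
  · exact h p hp hP k X f a b c d
  · haveI := CharP.charP_to_charZero k
    haveI : PerfectField k := PerfectField.ofCharZero
    exact hP k X f a b c d

/-- The crux with its antecedent dropped. -/
def CruxWithoutAntecedent : Prop := ∀ p : ℕ, p.Prime → ResolutionInChar.{0} p

/-- … is the summit itself (reviewer red flag: a proof of the crux not using the antecedent
proves resolution of singularities in characteristic `p` outright). [folklore] -/
theorem cruxWithoutAntecedent_iff : CruxWithoutAntecedent ↔ _root_.ResolutionOfSingularities :=
  Iff.rfl

/-- The crux with `[PerfectField k]` dropped from the antecedent. -/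
def CruxWithoutPerfect : Prop :=
  ∀ p : ℕ, p.Prime → (∀ (k : Type) [Field k] [CharP k p] (X : Scheme.{0}) (f : X ⟶ Spec (.of k)),
    IsSeparated f → LocallyOfFiniteType f → QuasiCompact f → IsReduced X →
      Scheme.HasResolution X) → ResolutionInChar.{0} p

/-- … is the identity: `[PerfectField k]` carries all the content. [folklore] -/
theorem cruxWithoutPerfect : CruxWithoutPerfect := fun _ _ h => h

/-- The antecedent with `IsReduced X` dropped. -/
def PerfectResNonreduced (p : ℕ) : Prop :=
  ∀ (k : Type) [Field k] [CharP k p] [PerfectField k] (X : Scheme.{0}) (f : X ⟶ Spec (.of k)),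
    IsSeparated f → LocallyOfFiniteType f → QuasiCompact f → Scheme.HasResolution X

/-- … is FALSE for every prime `p`: `Spec 𝔽_p[ε] → Spec 𝔽_p` is separated and of finite type over
the perfect field `𝔽_p` but `Spec 𝔽_p[ε]` has no resolution (landed:
`not_hasResolution_Spec_dualNumber`). [folklore] -/
theorem not_perfectResNonreduced (p : ℕ) [hp : Fact p.Prime] : ¬ PerfectResNonreduced p := by
  intro h
  have := h (ZMod p) (Spec (.of (DualNumber (ZMod p))))
    (Spec.map (CommRingCat.ofHom (algebraMap (ZMod p) (DualNumber (ZMod p))))) inferInstance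
    (locallyOfFiniteType_Spec_dualNumber (ZMod p)) inferInstance
  exact not_hasResolution_Spec_dualNumber (ZMod p) this

/-- The crux with `IsReduced` dropped from the antecedent. -/
def CruxWithoutReducedInAntecedent : Prop :=
  ∀ p : ℕ, p.Prime → PerfectResNonreduced p → ResolutionInChar.{0} p

/-- … holds VACUOUSLY (its antecedent is false), i.e. tells a prover nothing. [folklore] -/
theorem cruxWithoutReducedInAntecedent : CruxWithoutReducedInAntecedent := fun p hp h =>
  haveI : Fact p.Prime := ⟨hp⟩
  absurd h (not_perfectResNonreduced p)

/-- The consequent with `IsReduced X` dropped. -/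
def ResolutionInCharNonreduced (p : ℕ) : Prop :=
  ∀ (k : Type) [Field k] [CharP k p] (X : Scheme.{0}) (f : X ⟶ Spec (.of k)),
    IsSeparated f → LocallyOfFiniteType f → QuasiCompact f → Scheme.HasResolution X

/-- … is false for every prime (same witness). [folklore] -/
theorem not_resolutionInCharNonreduced (p : ℕ) [Fact p.Prime] : ¬ ResolutionInCharNonreduced p :=
  fun h => not_perfectResNonreduced p fun k _ _ _ X f a b c => h k X f a b c

/-- The crux with `IsReduced` dropped from the consequent. -/
def CruxWithoutReducedInConsequent : Prop :=
  ∀ p : ℕ, p.Prime → PerfectRes p → ResolutionInCharNonreduced p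

/-- … is equivalent to "resolution over perfect fields FAILS in every prime characteristic" — false
as soon as the perfect-field conjecture holds for one prime; not refutable today either. [folklore] -/
theorem cruxWithoutReducedInConsequent_iff :
    CruxWithoutReducedInConsequent ↔ ∀ p : ℕ, p.Prime → ¬ PerfectRes p := by
  refine ⟨fun h p hp hP => ?_, fun h p hp hP => absurd hP (h p hp)⟩
  haveI : Fact p.Prime := ⟨hp⟩
  exact not_resolutionInCharNonreduced p (h p hp hP)

/-! ## §3 Landed mechanisms, typed at the crux's shape

`Literature.Barriers.ResolutionOfSingularities.InseparableBaseChangeResolution` (p68332) and, once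
merged, `…RegularNotGeometricallyRegular` (p69541). The naive proof "descend `X` to a model `X₀`
over a field of definition `K₀` finitely generated over a perfect field, resolve `X₀` (generic
fibre of a resolved total space over the perfect field), base-change the resolution along
`K₀ → k`" needs the last step; it is false in general (non-reduced point, p68332) and false even
when the base change is integral (Kollár's curve, p69541). -/

/-- "A resolution of a model base-changes to a resolution": the step the naive proof needs, as a
proposition over all field extensions. -/
def ResolutionBaseChanges : Prop :=
  ∀ (K₀ k : Type) [Field K₀] [Field k] [Algebra K₀ k] (X₀ : Scheme.{0}) (f₀ : X₀ ⟶ Spec (.of K₀)),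
    IsSeparated f₀ → LocallyOfFiniteType f₀ → QuasiCompact f₀ → IsReduced X₀ →
      Scheme.HasResolution X₀ →
        Scheme.HasResolution (pullback f₀ (Spec.map (CommRingCat.ofHom (algebraMap K₀ k))))

/-- … refuted (landed witness `K₀ = 𝔽₂(t)`, `k = K₀(√t)`, `X₀ = Spec k`). [cite: Liu2002, Example
3.2.12] -/
theorem not_resolutionBaseChanges : ¬ ResolutionBaseChanges :=
  not_hasResolution_stable_groundFieldExtension

/-- "Regular models stay regular": refuted (same witness). [cite: Liu2002, Example 3.2.12 and
Remark 4.3.34] -/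
theorem not_regular_stable :
    ¬ ∀ (k K : Type) [Field k] [Field K] [Algebra k K] (X : Scheme.{0}) (f : X ⟶ Spec (.of k)),
      IsSeparated f → LocallyOfFiniteType f → QuasiCompact f → Scheme.IsRegular X →
        Scheme.IsRegular (pullback f (Spec.map (CommRingCat.ofHom (algebraMap k K)))) :=
  not_isRegular_stable_groundFieldExtension

open scoped TensorProduct in
/-- "Regular points of finitely generated algebras stay regular under `K ⊗ₖ −` at least when the
base change is a domain / the scheme is geometrically integral" — the refined ascent the naive
proof would need inside the crux (there `X/k` IS reduced) — is FALSE: Kollár's curve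
`A = 𝔽_p(t)[X,Y]/(Y² − X^p + t)` is regular at `𝔭 = (X^p − t, Y)` and `B = A_K ≅ K ⊗ₖ A`,
`K = k(t^{1/p})`, is not regular at the point over `𝔭` (landed p69541, all `p`; for `p > 2` the
curve is geometrically integral, Liu Ex. 7.3.15). [cite: Kollar2007, 1.19 (Curves over nonperfect
fields)] -/
theorem not_regular_ascends_pointwise (p : ℕ) [Fact p.Prime] :
    ¬ ∀ (k K : Type) [Field k] [Field K] [Algebra k K] (A : Type) [CommRing A] [Algebra k A]
      (B : Type) [CommRing B] [Algebra K B] (e : K ⊗[k] A ≃ₐ[K] B) (𝔭 : Ideal A) [𝔭.IsPrime]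
      (𝔓 : Ideal B) [𝔓.IsPrime], CharP k p → Algebra.FiniteType k A →
        (∀ a : A, e (1 ⊗ₜ a) ∈ 𝔓 ↔ a ∈ 𝔭) → IsRegularLocalRing (Localization.AtPrime 𝔭) →
          IsRegularLocalRing (Localization.AtPrime 𝔓) := by
  intro h
  obtain ⟨k, K, _, _, _, A, _, _, B, _, _, e, 𝔭, _, 𝔓, _, hchar, -, hft, hover, hreg, hnot⟩ :=
    RegularNotGeometricallyRegular p
  exact hnot (h k K A B e 𝔭 𝔓 hchar hft hover hreg)

/-! ## §4 `HasResolution` is not invariant under universal homeomorphisms (Frobenius twists)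

LANDED (p69878): `Literature.Barriers.ResolutionOfSingularities.FrobeniusTwistResolution` — for
`k = 𝔽_p(t)`, `K = k(s)`, `s^p = t`: the Frobenius twist `K^{(p)} = K ⊗_{k,Frob} k` is
`k[x]/(x^p − t^p) = k[x]/((x − t)^p)` (`insepPoly_map_frobenius`), one non-reduced point
(`isUnit_or_isNilpotent_frobTwist`, `not_isReduced_frobTwist`), so it has no resolution
(`not_hasResolution_Spec_frobTwist`) while `Spec K` is regular; the relative Frobenius
`Spec K → Spec K^{(p)}` (`x̄ ↦ s^p = t`, `exists_algHom_frobTwist_extField`) and the projection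
`Spec K^{(p)} → Spec K` (`s ↦ x̄`, `c ↦ c^p` on `k`, `exists_ringHom_extField_frobTwist`) are finite
universal homeomorphisms. Hence: resolving Frobenius twists / the perfect closure and "coming
back" by a power of Frobenius never yields a resolution of `X` itself, and reducing the twist first
loses the comparison map (headline `FrobeniusTwistResolution`). -/

/-- Re-export at the crux: **`HasResolution` is not invariant under finite universal
homeomorphisms, in either direction** — `Spec K` has a resolution, its Frobenius twist has none.
[cite: Liu2002, Example 3.2.12 and Prop. 3.2.7] -/
theorem hasResolution_not_invariant_univHomeo (p : ℕ) [Fact p.Prime] :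
    Scheme.HasResolution (Spec (.of (extField p))) ∧
      ¬ Scheme.HasResolution (Spec (.of (AdjoinRoot ((X - C (RatFunc.X : baseField p)) ^ p)))) :=
  ⟨hasResolution_Spec_extField p, not_hasResolution_Spec_frobTwist p⟩

/-! ## §5 What the antecedent buys: purely inseparable regular alterations (route pAlteration's `Pialt`)

ON PAPER (not formalised — needs perfect closures, EGA IV₃ §8 limits and IV₄ 17.7.8): assume
`PerfectRes p`; let `X/k` be integral, `k` ANY field of char `p`, `k^{perf}` its perfect closure.
`(X ×ₖ k^{perf})_{red}` is integral of finite type over the perfect field `k^{perf}`, so it has a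
resolution `Y → (X_{k^{perf}})_{red}`, `Y` regular = smooth over `k^{perf}`. Everything descends to a
finite purely inseparable `k ⊆ k' ⊆ k^{perf}`: `Y' → X_{k'}` proper, `Y'` smooth over `k'` (hence
regular), an isomorphism onto `(V')_{red}` over a dense open `V' ⊆ X_{k'}`; composing with the
finite universally injective `X_{k'} → X` gives `g : Y' → X` proper surjective, `Y'` integral
regular, finite and universally injective over a dense open — a PURELY INSEPARABLE REGULAR
ALTERATION. So `PerfectRes p ⇒ Pialt` at `p` (`PerfectResToPialt` below), and what is LEFT of the
crux after spending the antecedent this way is descending a resolution along a finite universally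
injective morphism onto/from a regular scheme — route pAlteration's `Picover` /
`PicoverToRadicialBottom` wall (Temkin 2013, Rem. 1.3.5 (iii): "the inseparable case, where all bad
things can happen"), open from dimension 4. The crux is therefore NOT cheaper than the inseparable
core of the summit unless the antecedent is used differently (§6 is the only other use known). -/

/-- `Pialt` (purely inseparable regular alteration) at the prime `p`: the body of
`Summit.ResolutionOfSingularities.ResolutionOfSingularities.Theses.PAlteration.Pialt`. -/
def PialtAt (p : ℕ) : Prop :=
  ∀ (k : Type) [Field k] [CharP k p] (X : Scheme.{0}) (f : X ⟶ Spec (.of k)),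
    IsSeparated f → LocallyOfFiniteType f → QuasiCompact f → IsIntegral X →
      ∃ (X' : Scheme.{0}) (g : X' ⟶ X), IsProper g ∧ IsIntegral X' ∧ Scheme.IsRegular X' ∧
        Function.Surjective g.base ∧ ∃ U : X.Opens, Dense (U : Set X) ∧ IsFinite (g ∣_ U) ∧
          UniversallyInjective (g ∣_ U)

/-- Unfolding of route pAlteration's crux. [folklore] -/
theorem pialt_iff :
    Summit.ResolutionOfSingularities.ResolutionOfSingularities.Theses.PAlteration.Pialt ↔
      ∀ p : ℕ, p.Prime → PialtAt p :=
  Iff.rfl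

/-- "Resolution over perfect fields gives purely inseparable regular alterations over all fields"
— TRUE ON PAPER (perfect closure + limit descent, see the section docstring); typed here for the
planners: it is what the antecedent of the crux buys for free. -/
def PerfectResToPialt : Prop := ∀ p : ℕ, p.Prime → PerfectRes p → PialtAt p

/-- Bookkeeping: with `PerfectResToPialt`, the perfect-field conjecture for all `p` gives route
pAlteration's crux `Pialt` outright. [folklore] -/
theorem pialt_of_perfectRes (h : PerfectResToPialt) (hP : ∀ p : ℕ, p.Prime → PerfectRes p) :
    Summit.ResolutionOfSingularities.ResolutionOfSingularities.Theses.PAlteration.Pialt :=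
  fun p hp => h p hp (hP p hp)

/-! ## §6 Provable sub-cases (typed) and the exact residue

MECHANISM THAT WORKS (on paper; Lean-heavy: Néron desingularisation is not needed, but spreading
out, generic fibres and EGA IV₂ 6.8.3/6.5.2 are): if `X ≅ X₀ ×_{K₀} k` with `K₀` finitely
generated over a perfect field `k₀` and `k/K₀` SEPARABLE (= `k` geometrically reduced over `K₀`,
Mathlib `Algebra.IsGeometricallyReduced K₀ k`, MacLane), spread `X₀` to `𝒳 → S`, `S` a
`k₀`-variety with function field `K₀`; resolve the reduced total space `𝒳` by the antecedent
(`k₀` perfect; dimension `dim X + trdeg`); its generic fibre `𝒳'_{K₀} → X₀` is a resolution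
(localisation of a regular scheme is regular — no field extension); base-change along the REGULAR
morphism `Spec k → Spec K₀` (flat with geometrically regular fibres BECAUSE `k/K₀` is separable):
regularity ascends (EGA IV₂ 6.5.2 with 6.8.3), properness and birationality are stable. This is
`PerfectToSeparableOverModel`; `K₀ = k` gives `PerfectToFinitelyGenerated` (the sub-item the
Descent planner proposes to split off; it contains Cossart–Piltant 2009's setting only when `k` is
finitely generated, NOT for all `[k : k^p] < ∞`: `𝔽_p((t))` has `[k : k^p] = p`).

THE RESIDUE, exactly: fields `k` with a reduced finite-type `X/k` admitting NO such model
(`HasSeparableFGModel` fails). `k/K₀` separable with `K₀/𝔽_p` finitely generated forces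
`trdeg K₀ ≤ p-rank(k)`; for `k = 𝔽_p((t))` (p-rank 1, algebraically closed elements = `𝔽_p`) every
admissible `K₀` is a global function field inside `k`, so any `X` whose isomorphism class carries
two algebraically independent moduli (e.g. `E_t ⊔ E_u`, elliptic curves with `j = t` and
`j = u = Σ t^{n!}`, or a genus-2 curve with independent Igusa invariants; multiply by `𝔸³` or build
the moduli into a 4-fold singularity to make it relevant) has no separable finitely generated
model. `LaurentSeriesCase p` types the smallest such ground field. (MacLane's criterion and the
moduli argument are on paper; not formalised.) -/

/-- Sub-case: `k` finitely generated (as a field: `Algebra.EssFiniteType`) over a perfect field.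
Believed PROVABLE from the antecedent (take `K₀ = k` in the mechanism above). -/
def PerfectToFinitelyGenerated : Prop :=
  ∀ p : ℕ, p.Prime → PerfectRes p → ∀ (k₀ k : Type) [Field k₀] [PerfectField k₀] [Field k]
    [CharP k p] [Algebra k₀ k], Algebra.EssFiniteType k₀ k →
      ∀ (X : Scheme.{0}) (f : X ⟶ Spec (.of k)), IsSeparated f → LocallyOfFiniteType f →
        QuasiCompact f → IsReduced X → Scheme.HasResolution X

/-- The crux implies it (so it is a genuine sub-item). [folklore] -/
theorem perfectToFinitelyGenerated_of_crux (h : Crux) : PerfectToFinitelyGenerated :=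
  fun p hp hP _ k _ _ _ _ _ _ X f a b c d => h p hp hP k X f a b c d

/-- Maximal provable sub-case: `X` is the base change of some `X₀` over `K₀`, `K₀` finitely
generated over a perfect field and `k/K₀` separable (`Algebra.IsGeometricallyReduced K₀ k`).
(`IsReduced` of the base change is asked explicitly; in the intended use it is the given `X`.) -/
def PerfectToSeparableOverModel : Prop :=
  ∀ p : ℕ, p.Prime → PerfectRes p → ∀ (k₀ K₀ k : Type) [Field k₀] [PerfectField k₀] [Field K₀]
    [Field k] [CharP k p] [Algebra k₀ K₀] [Algebra K₀ k], Algebra.EssFiniteType k₀ K₀ →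
      Algebra.IsGeometricallyReduced K₀ k →
        ∀ (X₀ : Scheme.{0}) (f₀ : X₀ ⟶ Spec (.of K₀)), IsSeparated f₀ → LocallyOfFiniteType f₀ →
          QuasiCompact f₀ →
            IsReduced (pullback f₀ (Spec.map (CommRingCat.ofHom (algebraMap K₀ k)))) →
              Scheme.HasResolution (pullback f₀ (Spec.map (CommRingCat.ofHom (algebraMap K₀ k))))

/-- The crux implies it. [folklore] -/
theorem perfectToSeparableOverModel_of_crux (h : Crux) : PerfectToSeparableOverModel := by
  intro p hp hP k₀ K₀ k _ _ _ _ _ _ _ _ _ X₀ f₀ a b c hred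
  haveI := a; haveI := b; haveI := c
  exact h p hp hP k _ (pullback.snd f₀ (Spec.map (CommRingCat.ofHom (algebraMap K₀ k))))
    inferInstance inferInstance inferInstance hred

/-- Existence of separable finitely generated models for every reduced finite-type `X` over every
field of characteristic `p` — the hypothesis under which the §6 mechanism proves the crux. TRUE for
`k` finitely generated over a perfect field, purely transcendental extensions, `𝔽_p(t_i)_{i ∈ I}`;
FALSE (on paper) for `k = 𝔽_p((t))` (moduli argument in the section docstring). -/
def HasSeparableFGModel (p : ℕ) : Prop :=
  ∀ (k : Type) [Field k] [CharP k p] (X : Scheme.{0}) (f : X ⟶ Spec (.of k)),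
    IsSeparated f → LocallyOfFiniteType f → QuasiCompact f → IsReduced X →
      ∃ (k₀ K₀ : Type) (_ : Field k₀) (_ : PerfectField k₀) (_ : Field K₀) (_ : Algebra k₀ K₀)
        (_ : Algebra K₀ k) (_ : Algebra.EssFiniteType k₀ K₀) (_ : Algebra.IsGeometricallyReduced K₀ k)
        (X₀ : Scheme.{0}) (f₀ : X₀ ⟶ Spec (.of K₀)) (_ : IsSeparated f₀) (_ : LocallyOfFiniteType f₀)
        (_ : QuasiCompact f₀),
        Nonempty (X ≅ pullback f₀ (Spec.map (CommRingCat.ofHom (algebraMap K₀ k))))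

/-- **The reduction the naive proof really achieves**: separable finitely generated models for all
`X` + the provable sub-case ⇒ the crux. Its first hypothesis fails for `𝔽_p((t))`, which is why
the crux is open. [folklore] -/
theorem crux_of_models (hM : ∀ p : ℕ, p.Prime → HasSeparableFGModel p)
    (hS : PerfectToSeparableOverModel) : Crux := by
  intro p hp hP k _ _ X f a b c d
  obtain ⟨k₀, K₀, _, _, _, _, _, _, _, X₀, f₀, _, _, _, ⟨e⟩⟩ := hM p hp k X f a b c d
  haveI := d
  have hred : IsReduced (pullback f₀ (Spec.map (CommRingCat.ofHom (algebraMap K₀ k)))) :=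
    isReduced_of_isOpenImmersion e.inv
  exact (hS p hp hP k₀ K₀ k ‹_› ‹_› X₀ f₀ ‹_› ‹_› ‹_› hred).of_iso e.inv

/-- `𝔽_p((t))` has characteristic `p`. [folklore] -/
instance charP_laurentSeries (p : ℕ) [Fact p.Prime] : CharP (LaurentSeries (ZMod p)) p :=
  charP_of_injective_algebraMap (algebraMap (ZMod p) (LaurentSeries (ZMod p))).injective p

/-- THE RESIDUAL HARD CASE, typed: resolution of reduced separated finite-type schemes over
`k = 𝔽_p((t))` (p-rank 1; admits no separable finitely generated model in general). A prover who
can do this case from `PerfectRes p` has found a use of the antecedent other than §5/§6. -/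
def LaurentSeriesCase (p : ℕ) [Fact p.Prime] : Prop :=
  ∀ (X : Scheme.{0}) (f : X ⟶ Spec (.of (LaurentSeries (ZMod p)))),
    IsSeparated f → LocallyOfFiniteType f → QuasiCompact f → IsReduced X → Scheme.HasResolution X

/-- The crux implies the Laurent-series case. [folklore] -/
theorem laurentSeriesCase_of_crux (h : Crux) (p : ℕ) [hp : Fact p.Prime] (hP : PerfectRes p) :
    LaurentSeriesCase p := fun X f a b c d => h p hp.out hP _ X f a b c d

/-! ## §7 Near-misses and open regimes (no sorries this generation)

(i) ISOLATED SINGULARITIES OVER `𝔽_p((t))`: finite determinacy makes an isolated hypersurface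
singularity over `k = 𝔽_p((t))` formally/étale-locally isomorphic to one with coefficients
truncated to rational functions, i.e. defined over `𝔽_p(t) ⊂ k` — and `k/𝔽_p(t)` IS separable
(`t` stays a `p`-basis). So §6 resolves an étale neighbour; gluing/descending that resolution to
`X` is an ÉTALE (Galois) descent of non-functorial resolutions — crux 0550's problem
(`DescentAlgclosedToPerfect`), not 0549's. Recorded as a lead, not a claim.
(ii) No content in dimension ≤ 3 (`crux_iff_dim_gt_three`), none over perfect or finitely
generated fields (§6), none for non-reduced schemes (§2).
(iii) Irrefutability: `not_crux_iff` — a refutation of this crux is a counterexample to resolution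
of singularities in characteristic `p` (dim ≥ 4, imperfect ground field) PLUS the perfect-field
theorem for that `p`; the standing adversary's useful output is therefore §2–§6, not `¬ Crux`. -/

/-- Certificate restated for the harness: refuting the crux refutes the summit. [folklore] -/
theorem not_summit_of_not_crux (h : ¬ Crux) : ¬ _root_.ResolutionOfSingularities :=
  fun hs => h (crux_of_summit hs)

/-! ## §8 Cards on file (crux-ideate round 1) — what the findings say

Read: `Cruxes/DescentPerfectToAll/Ideas/{frobenius-sandwich-foliation, lambda-tower-one-step,
constant-foliation-descent, arc-special-fibre-transversality}.md` and `SketchIdeator{1,3}.lean`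
(all four say "Disproof used: none available" — this file now exists at the publish path).

* ALL FOUR levers open with §5 (perfect closure ⇒ a SMOOTH purely inseparable top model over a
  finite `k₁/k`; cards 1, 3) or §6 (perfect-field families / f.g. subfields INSIDE `k`; cards 2, 4)
  and none base-changes a regular scheme along an inseparable extension hoping it stays regular —
  so the landed negatives (p68332, p69541, §4) bite none of them; they were designed around the
  barrier. Calibration instances now in the tree for them: Kollár's curve (p69541) is (i) a
  height-one "sandwich" `𝔸¹_{k₁} → C → (𝔸¹)^{(p)}` with SMOOTH arithmetic foliation and regular
  non-smooth quotient (card 1), (ii) a regular `E`-curve with `E = 𝔽_p(t)` λ-closed in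
  `k = 𝔽_p((t))`, consistent with `OneStepDetection` (card 2: `C ⊗ k` regular since `t ∉ k^p`),
  (iii) the first factor of card 4's cheapest falsifier `{y² = a^p − t} × {z² = b^p − u}`.
* Card 2's ONE-STEP LEMMA checked on paper here: with `B = {t}` a p-basis of `k`, `E ⊇ B`,
  `Γ_{k/E} = ker(Ω_E ⊗ k → Ω_k)` is spanned by `θ_x = dx − ∂_t(x)dt`, `∂_t x = Σ j λ_j(x)^p t^{j−1}
  ∈ E⁽¹⁾`, and the same elements span `Γ_{E⁽¹⁾/E}`; all modules are vector spaces over fields so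
  `⊗ κ(z)` is exact — no objection. `SeparableAscent`, `PerfectClosureDescent`,
  `PropagationFromClosedFibre` (proper ⇒ closed; closures meet the closed fibre; Reg open and
  generisation-stable), `KunzCriterion`, `RegularDescendsFlatLocal`: printed theorems / routine.
* Card 3's first lemma is MIS-TYPED (below): nonsingularity of `D` in one direction does not make
  `⟨D⟩` p-closed, and `ker D` only sees the restricted Lie algebra generated by `D`. -/

/-- Card constant-foliation-descent, first lemma, VERBATIM from `SketchIdeator1.lean`
(`…Cruxes.descent_perfect_to_all.Sketch.InvariantsRegularOfNonsingularDerivation`). -/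
def InvariantsRegularOfNonsingularDerivation (p : ℕ) [Fact p.Prime] : Prop :=
  ∀ (R : Type) [CommRing R] [IsRegularLocalRing R] [CharP R p] (D : Derivation ℤ R R)
    (S : Subring R), (∀ x : R, x ∈ S ↔ D x = 0) → Module.Finite S R →
    (∃ x : R, IsUnit (D x)) → IsRegularLocalRing S

/-- The REPAIRED first lemma (Aramova–Avramov's actual hypothesis: `D` generates a p-closed,
i.e. genuinely rank-one, foliation — `D^p = a·D`; equivalently `[Frac R : Frac S] = p`). Stated,
not proved. -/
def InvariantsRegularOfPClosedNonsingularDerivation (p : ℕ) [Fact p.Prime] : Prop :=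
  ∀ (R : Type) [CommRing R] [IsRegularLocalRing R] [CharP R p] (D : Derivation ℤ R R)
    (S : Subring R), (∀ x : R, x ∈ S ↔ D x = 0) → Module.Finite S R →
    (∃ a : R, ∀ x : R, (⇑D)^[p] x = a * D x) →
    (∃ x : R, IsUnit (D x)) → IsRegularLocalRing S

/-- **NEAR-MISS (typed, on-paper refutation; the only `sorry` in this file): the card's first lemma
is false as typed.** WITNESS: `k` any field of characteristic `p`, `R = k⟦x, y, z⟧` (regular
local), `E = y∂_y + z∂_z` (Euler field), `D = ∂ₓ + x·E` (a `ℤ`-derivation of `R`), `S = ker D`.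
* `D x = 1` is a unit ✓; `R` is module-finite over `k⟦x^p, y^p, z^p⟧ ⊆ S` (`E(y^p) = 0`), hence
  over `S` ✓.
* `D` is NOT p-closed: `[∂ₓ, xE] = E` is central in `⟨∂ₓ, xE, E⟩`, so by Jacobson's formula
  `D^p = ∂ₓ^p + x^pE^p = x^p·E` for `p ≥ 3` (`E^p = E`), and `D² = (1 + x²)E` for `p = 2`;
  `x^pE ∉ R·D`.
* `ker D`: writing `f = Σ_n f_n(y,z) xⁿ`, `Df = 0` ⟺ `(m+1) f_{m+1} + E f_{m−1} = 0` for all `m`;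
  this forces `f_n = 0` for `p ∤ n` and `E f_n = 0` for `p ∣ n`, i.e.
  `S = (k⟦y,z⟧^E)⟦x^p⟧ = k⟦x^p⟧ ⊗̂ k⟦yⁱzʲ : i + j ≡ 0 (mod p)⟧` — the cyclic quotient
  singularity `(1/p)(1,1)` (cone over the rational normal curve of degree `p`) times a line:
  local, Noetherian, of dimension 3 and embedding dimension `p + 2 ≥ 4`, NOT regular.
So `IsRegularLocalRing S` fails. The point: `ker D` is the ring of constants of the RESTRICTED Lie
algebra generated by `D`, here `⟨∂ₓ, E⟩` of rank two with a multiplicative zero of `E`; one unit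
value `D x` only makes the `∂ₓ`-direction harmless. REPAIR: `InvariantsRegularOfPClosedNonsingularDerivation`
(add `D^p ∈ R·D`). Why `sorry`: the Lean cost is the power-series invariant computation
(`MvPowerSeries` derivations, finiteness over `p`-th powers, the coefficient recursion and the
embedding-dimension count of the Veronese cone) — none of it conceptual.
GEN 3 (2026-08-16): DONE IN LEAN with `R = 𝔽_p⟦X₀,X₁,X₂⟧` — the cost was paid with the tree's
`isRegularLocalRing_mvPowerSeries` / `ringKrullDim_mvPowerSeries` / `MvPowerSeries.pderiv` /
`eulerDerivation` / `mem_span_pMonomials` / `ringKrullDim_eq_of_isIntegral`; instead of the full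
kernel only two vanishing statements are used (a constant has no `X₀ⁱ`, `p ∤ i`, and no `X₁ᵇX₂ᶜ`,
`p ∤ b + c` — the latter by the DESCENDING even chain from the recursion at `j = 2p − 1`, where the
factor `2p` dies), and non-regularity is the count "4 test monomials `X₀^p, X₁^p, X₁^{p-1}X₂, X₂^p`
with multiplicative test coefficients ⇒ `𝔪_S` needs ≥ 4 generators > 3 = dim S". Theorem
`Summit.ResolutionOfSingularities.ResolutionOfSingularities.Theorems.DescentPerfectToAll.Negative.not_invariantsRegularOfNonsingularDerivation`
(its statement is this `def` unfolded; LANDED p73716 + p73820 — the `sorry` below is bookkeeping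
only: replace by `exact Summit.ResolutionOfSingularities.ResolutionOfSingularities.Theorems.DescentPerfectToAll.Negative.not_invariantsRegularOfNonsingularDerivation p`
after `import …Theorems.DescentPerfectToAll.Negative.InvariantsRegularOfNonsingularDerivationFalse`,
as soon as the farm serves that module). [folklore] -/
theorem not_invariantsRegularOfNonsingularDerivation (p : ℕ) [Fact p.Prime] :
    ¬ InvariantsRegularOfNonsingularDerivation p := by
  sorry  -- LANDED: …Theorems.DescentPerfectToAll.Negative.not_invariantsRegularOfNonsingularDerivation (p73820)

/-! ## §9 Triage round 1 digest (gen 3) — typed verdicts on the cards' first lemmas, for the lead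

Inputs: `Ideas/*.md` (6 cards), `SketchIdeator{1,2,3}.lean`, `TRIAGE-r1-{1,2,3}.md` (2026-08-16T00:25–00:29Z).
Panel: PASS arc-special-fibre-transversality, constant-foliation-descent (first lemma false as typed —
repair p-closed — now PROVED false, §8), root-of-a-constant (stacky reading (3b) only),
lambda-tower-one-step, frobenius-sandwich-foliation; FAIL absolutize-the-datum (its Transfer
"absolute WeightedConstruction for all p" gives `ResolutionInChar p` with the antecedent unused —
literally `cruxWithoutAntecedent_iff` of §2, i.e. the summit in route WeightedInvariant's clothes; a
route-repair proposal for crux #2, not a line here). MERGES: constant-foliation-descent ≈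
frobenius-sandwich-foliation ≈ root-of-a-constant; arc-special-fibre-transversality ≈ lambda-tower-one-step.

Typed first lemmas on file and this adversary's verdict (paper unless stated):
* `InvariantsRegularOfNonsingularDerivation p` (SketchIdeator1) — **FALSE, kernel-checked** (§8;
  Negative files). Repair `InvariantsRegularOfPClosedNonsingularDerivation` (§8) — TRUE (rescale to
  `D x = 1`, then `D^p x = 0` forces `D^p = 0`; char-p Taylor ⇒ `R` free over `S` on
  `1, x, …, x^{p-1}`; `S` Noetherian local; `IsRegularLocalRing.of_flat_of_isLocalHom`).
* `taylor_expansion_of_derivation` (SketchIdeator2) — TRUE as typed (existence by induction on the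
  `δ`-nilpotency degree using that `1, …, p-1` are units in a `CharP _ p` ring; uniqueness by applying
  `δ^{p-1}, δ^{p-2}, …`).
* `kummer_cover_of_constant_regular_iff` (SketchIdeator2) — TRUE as typed, even without `IsUnit a`
  (`O[T]/(T^p − a)` is local; at `𝔑 = (𝔪, T − c₀)` regular iff `T^p − a ∉ 𝔑²` iff
  `a − c₀^p ∉ 𝔪²`; for `c̄ ≠ c̄₀` the element `a − c^p` is a unit).
* `derivations_free_of_regular_Ffinite` (SketchIdeator2) — TRUE in print (Kunz's conjecture,
  Kimura–Niitsuma 1982: an F-finite regular local ring has a p-basis), heavy; belongs to crux #2.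
* `PropagationFromClosedFibre`, `KunzCriterion p`, `RegularDescendsFlatLocal` (SketchIdeator1) — TRUE
  (proper ⇒ closed points of `Y` lie over the closed point; `Reg` open is generisation-stable /
  Kunz 1969 Thm 2.1 / in tree `IsRegularLocalRing.of_flat_of_isLocalHom`).
* `OneStepDetection p`, `SeparableAscent`, `PerfectClosureDescent p` (SketchIdeator3) — TRUE on paper
  (triagers 1–3 re-derived the `Γ_{k/E}` computation; EGA IV₂ 6.8.3/6.5.2; §5 of this file).
So the merged lines carry NO false typed lemma other than the §8 one; their risk is in the untyped
transfers:
* root-of-a-constant, SCHEME-level `(★★)₂` ("a height-one constant extension `F ⊂ F(a^{1/p})` with a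
  regular proper model upstairs has a regular proper model `M` downstairs with `(M ⊗ k')^ν`
  regular") — REFUTED ON PAPER for every `p ≥ 5` by TRIAGE-r1-1 App. A (`k'(E × E)`, `E`
  supersingular, `D = ∂_α + ∂₁ + λ(y/x)∂₂`: every regular proper `k'`-model is an iterated point
  blow-up of the abelian surface and keeps a non-Euler multiplicative singular point of the constant
  foliation; the quotient germ is `C₁[α̃]` with `C₁` the non-regular `(1/p)(a,b)` toric germ, and
  regularity would descend to `C₁` by flatness). Not formalisable at present (abelian surfaces,
  models); recorded here as the line's standing refutation instance — the STACKY reading (3b)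
  (weighted blow-up `(1, λ̃)`) survives it.
* Common honesty clause (all five survivors): the local core is a purely inseparable hypersurface germ
  `T^p = h(y₁, …, y_d)` in `d = dim X` variables (root-of-a-constant (3a), verified by triager 1), so
  `Literature.Barriers.ResolutionOfSingularities.DimensionFourFrontier` / `KangarooShadeIncrease` /
  `ResidualOrderUnbounded` bite every line LOCALLY at `d = 4` — exactly §5's prediction that the
  residue of 0549 after spending the antecedent is pAlteration's `Picover`/`RadicialBottom` wall. What
  the cards add is GLOBAL structure (constancy of the foliation, explicit λ-levels); that is the bet.
-/

/-! ## §10 Targets — the PICKED line `arc-special-fibre-transversality` (lead skeleton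
`Lines/arc-special-fibre-transversality.lean`, 2026-08-16T01:24Z): stub audit by the standing adversary

Verdict per stub (paper; the line composes, `DescentPerfectToAll_of` type-checks):
* `stub_fgModel` — TRUE (EGA IV₃ 8.8.2 + 8.10.5; `X₀` may be taken reduced because
  `(X₀)_red ×_{K₀} k ↪ X` is a nil-immersion into a reduced scheme, hence an isomorphism).
* `stub_propagation` — TRUE as typed, WITHOUT Noetherianity of `R` (not assumed there): `𝒴` is
  quasi-compact (proper over affine), every point specialises to a closed point of `𝒴`, a closed
  point maps to a closed point of `Spec R` (`g` closed) = `closedPoint R`, `Reg 𝒴` is open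
  (`Scheme.isOpen_regularLocus_of_isQuasiExcellent`) hence generisation-stable; the generic fibre is
  a localisation (Serre: `isRegularRing_of_isRegularLocalRing`).
* `stub_regularOfFiniteLevels` — TRUE as typed, in EVERY characteristic (no `CharP` there): descent
  `Y_Ω regular ⇒ Y_{L'} regular` (faithfully flat, Matsumura 23.7 = `of_flat_of_isLocalHom`), then
  `𝒪_{Y_k,y} = colim_{L'} 𝒪_{Y_{L'},y_{L'}}` (flat local transitions, `𝔪 = ⋃ 𝔪_{L'}𝒪`), and
  `Tor^{𝒪}_n(κ,κ) = colim Tor^{𝒪_{L'}}_n(κ_{L'},κ_{L'}) = 0` for `n > dim Y` uniformly ⇒ `pd κ < ∞` ⇒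
  regular (Serre); Kunz is not needed. (Char 0: take `L' = L`, regular = smooth over a perfect field.)
* `stub_resolutionOfRobustModel` — TRUE as typed, even without reducedness of `X₀ ×_{K₀} k`:
  `Spec k → Spec L` is universally OPEN (EGA IV₂ 2.4.9), so dense opens and their dense preimages
  pull back to dense opens and `IsBirational` is stable under ground-field extension; properness and
  the regularity hypothesis do the rest. (A fat point `X₀ ×_{K₀} L` makes the hypothesis fail, not the
  conclusion: `IsBirational` onto a one-point scheme forces `Y ≅` it.)
* `stub_closedFibreModels` (THE CORE) — NOT REFUTABLE: summit-implied, but only via the following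
  route, which the lead's PICKED note states loosely ("shrunk to its regular locus" loses properness):
  (1) compactify FIRST — `X₀ ⊆ X̄₀` Nagata over `K₀`; a resolution `X̃ → X̄₀ ×_{K₀} k` (summit)
  descends to `Ȳ → X̄₀ ×_{K₀} L` over a f.g. `L`, and `Y := Ȳ|_{X₀}` is proper birational over
  `X₀ ×_{K₀} L` with `Y ⊆ Ȳ` OPEN and `Ȳ` proper over `L` — this is what makes the open immersion
  `j` available for the FIXED `Y` (with the tree's WEAK `HasResolution`, no later resolution of a
  model can be assumed to be an isomorphism over `Y`, so `Y` must never be modified again);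
  (2) for f.g. `L' ≥ L`: `Ȳ_{L'}` is regular (it descends from `X̃ = Ȳ_{L'} ×_{L'} k` by faithful
  flatness), hence so is `Ȳ_F`, `F := L'·𝔽̄_p` (separable algebraic over `L'`); spread `Ȳ_F` to a
  proper model `𝒴_B → B` over a smooth `𝔽̄_p`-variety `B` with function field `F`; `Reg(𝒴_B)` is
  open (excellence) and contains the generic fibre, so its closed complement has closed image in `B`
  missing the generic point: over a non-empty open `B° ⊆ B` the model is regular; (3) take a CLOSED
  point `b ∈ B°`, `R := 𝒪_{B,b}` (Noetherian local domain, residue field `𝔽̄_p` perfect,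
  `Frac R = F ⊇ L'`), `𝒴 := 𝒴_B ×_B Spec R` (proper, quasi-excellent, regular EVERYWHERE), and
  `j : Y_F ⊆ Ȳ_F = 𝒴_η` open. No resolution of `𝒴` is used — only openness of `Reg`.
  CONVERSELY the stub is CRUX-COMPLETE: with stubs 3–4 any witness forces `Y ×_L k` regular, i.e. a
  resolution of `X`; so the stub is exactly as hard as the crux and the antecedent `H` (perfect
  fields) enters nowhere in (1)–(3) except through the summit. The honest first target is therefore
  the ARITHMETIC sub-statement the card really proposes: `R = κ⟦t⟧`, `φ` a non-constant arc
  `L' ↪ κ((t))`, `𝒴` a proper `κ⟦t⟧`-model regular along the closed fibre — resolution of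
  `(d+1)`-dimensional schemes over an equicharacteristic excellent DVR near the closed fibre, which
  `H` does NOT provide either (H is about varieties over perfect FIELDS); for `d + 1 = 4` this is
  CossartPiltant2019 (in tree, arbitrary quasi-excellent 3-folds) and is open from `d + 1 = 5`.
* JUNK `R` EXCLUDED (refuted strengthenings, on paper): `R` can never be taken to be a FIELD, nor any
  local domain with `Frac R ⊇ L'^{perf}` (e.g. `κ⟦t⟧` with `L' ⊆ κ` constant): then the closed
  fibre is everything (resp. `κ((t))/κ` is separable), `Y_{L'^{perf}}` would be regular, i.e.
  `Y_{L'}` SMOOTH over `L'` — and a proper birational model smooth over the ground field does not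
  exist in general: `SmoothModelAfterFGEnlargement` below is FALSE for every prime `p` (witness
  `k = K₀ = 𝔽_p(a)`, `X₀` the regular non-smooth projective curve `y² = x^p − a` (`p` odd) /
  `y³ = x² + a` (`p = 2`): `L = k` is forced, and a proper birational `Y → X₀` with `Y` smooth is a
  regular curve finite birational over the normal curve `X₀`, hence `≅ X₀`, not smooth). So the arc
  `φ` MUST be non-constant (transcendental digits), exactly the card's mechanism (M2) — recorded as
  the near-miss `not_smoothModelAfterFGEnlargement` (sorry: needs curves/normalisation in Lean). -/

/-- Refuted strengthening of `stub_closedFibreModels` (what `R` = a perfect field, or any `R` with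
`Frac R ⊇ L'^{perf}`, would force): after a finitely generated enlargement of the field of
definition there is a proper birational model SMOOTH over the ground field. -/
def SmoothModelAfterFGEnlargement (p : ℕ) : Prop :=
  ∀ (k : Type) [Field k] [CharP k p] (K₀ : Subfield k) (s : Finset k),
    K₀ = Subfield.closure (↑s : Set k) →
    ∀ (X₀ : Scheme.{0}) (f₀ : X₀ ⟶ Spec (.of K₀)), IsSeparated f₀ → LocallyOfFiniteType f₀ →
      QuasiCompact f₀ → IsReduced X₀ →
      IsReduced (pullback f₀ (Spec.map (CommRingCat.ofHom K₀.subtype))) →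
      ∃ (L : Subfield k) (hL : K₀ ≤ L) (t : Finset k), L = Subfield.closure (↑t : Set k) ∧
        ∃ (Y : Scheme.{0})
          (π : Y ⟶ pullback f₀ (Spec.map (CommRingCat.ofHom (Subfield.inclusion hL)))),
          IsProper π ∧ IsBirational π ∧
            Smooth (π ≫ pullback.snd f₀ (Spec.map (CommRingCat.ofHom (Subfield.inclusion hL))))

/-- **NEAR-MISS (on paper, every prime `p`): `SmoothModelAfterFGEnlargement p` is false** — witness
`k = K₀ = 𝔽_p(a)` (so `L = k`), `X₀` the regular, geometrically integral, non-smooth projective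
curve `y² = x^p − a` (`p` odd; `y³ = x² + a` for `p = 2`): a proper birational `Y → X₀` with `Y`
smooth over `k` is a regular curve finite and birational over the NORMAL curve `X₀`, hence an
isomorphism, but `X₀` is not smooth (Kollár 2007, 1.19; ring-level non-smoothness is the landed
`Literature.Barriers.ResolutionOfSingularities.RegularNotGeometricallyRegular`). Why `sorry`: the
scheme-level facts (dimension of a birational model, finiteness of proper quasi-finite maps,
`X₀` normal ⇒ finite birational is iso, smoothness vs. the landed singular base change) are not in
the tree at this generality; nothing conceptual. Consequence for the line: in `stub_closedFibreModels`
the local domain `R` must have `Frac R ⊉ L'^{perf}` — the arc `φ : L' → Frac R` must be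
NON-CONSTANT (transcendental digits), as in the card's (M2). [cite: Kollar2007, 1.19] -/
theorem not_smoothModelAfterFGEnlargement (p : ℕ) [Fact p.Prime] :
    ¬ SmoothModelAfterFGEnlargement p := by
  sorry

end Summit.ResolutionOfSingularities.ResolutionOfSingularities.Cruxes.DescentPerfectToAll.Disproof

end
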